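import Literature.MathematicalPhysics.QuantumFieldTheory.Balaban1983to89.B8Eq191FlatLettersDirichlet
import Literature.MathematicalPhysics.QuantumFieldTheory.Balaban1983to89.B8CubeMemberZd

/-!
# `Balaban1983to89.B8Eq191FlatLettersCubeMember` — [Balaban1985RegularSpaces] Prop. 6 p. 99 ∕ (1.91) p. 91: the seven flat [4]-letters of
# `B8Eq191FlatLettersDirichlet.exists_flatLetters_dirichlet` AT THE CONCRETE CUBE MEMBER `{□_j}` OF (1.131) (`Ω_j := cubeFam false`, truncated
# structure `Λs := cubeLamS … m` of `B8CubeMemberZd`) — the finiteness and the TOWER GEOMETRY (blocks over `𝔅_m` pairwise disjoint on `□₀`, each meeting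
# `□₀`) PROVED for this member, so the letters exist there with NO displayed geometric hypothesis

statement-level skeleton of published theorems with citation tags; proofs where landed; nothing here is a claim about the
Yang–Mills mass gap

`[Balaban1985RegularSpaces]` ("B8", CMP **99** (1985) 75–102) (1.5)–(1.6) p. 77, (1.68) p. 88, (1.91) p. 91, p. 98 («for every j the cube □_j is a sum of
the big blocks of the lattice T_{L^{−j}}»), (1.131) p. 99, Prop. 6 p. 99; [4] = `[Balaban1985BackgroundPropagators]` Thm 3.1 p. 397, (3.25) p. 394;
[B6] = `[Balaban1984PropagatorsII]` p. 235.

CITATION HEADER (lean-in-tree rule).  Cell `pub-ymgap` (D-0062), DAG node N05 = [B8], seat `pub-ymgap-dag-n05-e` (g3; R141 (C), FAN-OUT §N05 row s3b — THE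
FLAT CURRENCY for Proposition 6).  `exists_flatLetters_dirichlet` displays: `Ω₀` finite, `Λ_j` finite, the tower blocks `{z ∣ y_j(z) = y}` (`y ∈ Λ_j`,
`j ≤ m`) pairwise disjoint on `Ω₀` and meeting `Ω₀`.  THIS FILE proves them for the cube member of n05-c's `B8CubeMemberZd` (`Ω₀ = □₀ =
cubeFam false L a M ρ k 0`, `Λs = cubeLamS L a M ρ k m`, `m ≤ k`, `1 ≤ L ≤ ρ`): §1 boxes of `ℤᵈ` are finite (`inBox_finite`, `cubeLamS_finite`,
`cubeFam_zero_finite`); the block dictionary `Under L j y z ↔ blockMap (Lʲ) z = y` (`under_iff_blockMap_eq`); `□_j ⊂ □₀` (`cubeFam_subset_zero`);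
`hmeet` (`tower_meets_cube`: `Lʲ•y ∈ □_j ⊂ □₀` lies under `y`); `hdisj` (`towers_disjoint_cube`: a fine site under `y ∈ Λ_j = □_j^{(j)} ∖ □_{j+1}^{(j)}`
and under `y′ ∈ Λs j′`, `j < j′`, would lie in `□_{j′} ⊂ □_{j+1}`, a union of `Lʲ`-blocks — forcing `Lʲ•y ∈ □_{j+1}`, i.e. `y ∈ □_{j+1}^{(j)}`);
§2 ★ `exists_flatLetters_cubeMember`: the seven letters with the twelve algebraic laws at the cube member, hypotheses `0 < d`, `η ≠ 0`,
`1 ≤ L ≤ ρ`, `m ≤ k`, weights `≥ 0` ONLY.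

HONEST SCOPE.  Lattice bookkeeping + instantiation; NO estimate (the five bounds (1.92) ∕ (1.98) ∕ (1.101) remain).  Count-neutral; N05 NOT discharged;
one finite `T⁴` programme at fixed `ε`, Bałaban as printed; nothing continuum ∕ ℝ⁴ ∕ OS ∕ mass-gap ∕ Clay.  No `sorry`, no `def`, no `instance`, no `notation`.
Unit `pub-ymgap-dag-n05-e` (g3), 2026-08-27.
-/

noncomputable section

namespace Literature.MathematicalPhysics.QuantumFieldTheory.Balaban1983to89.B8Eq191FlatLettersCubeMember

open B7Prop1Explicit (e)
open B7Prop1Local (InBox)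
open B7Eq78Linearization (QprimeIter zdBlocking)
open B8Ineq132 (Under)
open B8Eq119TwistedAxial (bgT)
open B8Eq138LandauZd (covLap QT)
open B8Eq1117Concrete (XSpace)
open B8Eq131Cubes (cube sqLo sqHi inLo inHi flm under_flm mem_cube_iff)
open B8Eq131CubesAdmissible (cubeFam cubeFam_false_of_le smul_mem_cube_iff smul_mem_cube_succ_iff)
open B8CubeMemberZd (cubeLam cubeLamS cubeLamS_of_lt inBox_sq_of_mem_cubeLamS hΩ_cubeFam)
open B8Ineq166Univ (under_add_of_under)
open Literature.MathematicalPhysics.QuantumLattice (blockMap)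
open B8Eq191FlatLettersDirichlet (exists_flatLetters_dirichlet)

variable {d : ℕ}

/-! ## §1 Finiteness and the tower geometry of the cube member -/

/-- A box `[lo, hi]` of `ℤᵈ` is finite. [folklore] [cite: Balaban1985RegularSpaces, p.98] -/
theorem inBox_finite (lo hi : Fin d → ℤ) : {x : Fin d → ℤ | InBox lo hi x}.Finite := by
  refine (Set.finite_Icc lo hi).subset fun x hx => ?_
  simp only [Set.mem_setOf_eq, InBox] at hx
  exact ⟨fun i => (hx i).1, fun i => (hx i).2⟩

/-- The truncated restriction sets `cubeLamS … m j` of the cube member are finite. [cite: Balaban1985RegularSpaces, (1.5) p.77, (1.131) p.99] -/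
theorem cubeLamS_finite (L : ℕ) (a : Fin d → ℤ) (M ρ k m j : ℕ) : (cubeLamS L a M ρ k m j).Finite :=
  (inBox_finite (sqLo L a ρ k j) (sqHi L a M ρ k j)).subset fun _ hz => inBox_sq_of_mem_cubeLamS hz

/-- `Ω₀ = □₀` of the cube member is finite. [cite: Balaban1985RegularSpaces, p.98] -/
theorem cubeFam_zero_finite (L : ℕ) (a : Fin d → ℤ) (M ρ k : ℕ) : (cubeFam false L a M ρ k 0).Finite := by
  rw [cubeFam_false_of_le L a M ρ (Nat.zero_le k)]
  exact inBox_finite _ _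

/-- The `Lʲ`-block label is `flm`. [folklore] [cite: Balaban1985RegularSpaces, p.79] -/
theorem blockMap_pow_eq_flm (L j : ℕ) (z : Fin d → ℤ) : blockMap (L ^ j) z = flm L j z := by
  funext i
  simp [blockMap, flm, Nat.cast_pow]

/-- **Block dictionary**: `z ∈ Bʲ(y)` iff the `Lʲ`-block label of `z` is `y`. [cite: Balaban1985RegularSpaces, p.79 («x₀ ∈ Bʲ(x_j)»)] -/
theorem under_iff_blockMap_eq {L : ℕ} (hL : 1 ≤ L) (j : ℕ) (y z : Fin d → ℤ) : Under L j y z ↔ blockMap (L ^ j) z = y := by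
  have hL0 : (0 : ℤ) < (L : ℤ) := by exact_mod_cast hL
  have hpos : (0 : ℤ) < (L : ℤ) ^ j := pow_pos hL0 j
  rw [blockMap_pow_eq_flm]
  constructor
  · intro h
    funext i
    obtain ⟨h1, h2⟩ := h i
    simp only [flm]
    have hlo : y i ≤ z i / (L : ℤ) ^ j := Int.le_ediv_of_mul_le hpos (by rw [mul_comm]; exact h1)
    have hhi : z i / (L : ℤ) ^ j < y i + 1 := Int.ediv_lt_of_lt_mul hpos (by rw [mul_comm]; linarith)
    omega
  · intro h
    rw [← h]
    exact under_flm hL j z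

/-- `flm` composes: the `L`-block of the `Lʲ`-block label is the `L^{j+1}`-block label. [folklore] [cite: Balaban1985Averaging, (3) p.17] -/
theorem flm_one_flm (L j : ℕ) (z : Fin d → ℤ) : flm L 1 (flm L j z) = flm L (j + 1) z := by
  funext i
  simp only [flm]
  rw [pow_one, pow_succ]
  exact Int.ediv_ediv_of_nonneg (pow_nonneg (Int.natCast_nonneg L) j)

/-- `Lʲ•y ∈ Bʲ(y)`. [folklore] [cite: Balaban1985RegularSpaces, p.79] -/
theorem under_smul_self {L : ℕ} (hL : 1 ≤ L) (j : ℕ) (y : Fin d → ℤ) : Under L j y (((L : ℤ) ^ j) • y) := by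
  rw [under_iff_blockMap_eq hL, blockMap_pow_eq_flm]
  funext i
  have hne : (L : ℤ) ^ j ≠ 0 := pow_ne_zero j (by exact_mod_cast (Nat.one_le_iff_ne_zero.mp hL))
  simp only [flm, Pi.smul_apply, smul_eq_mul]
  exact Int.mul_ediv_cancel_left _ hne

/-- `□_j ⊂ □₀` (iterated (1.3)). [cite: Balaban1985RegularSpaces, (1.3) p.77] -/
theorem cubeFam_subset_zero {L : ℕ} (hL : 1 ≤ L) (a : Fin d → ℤ) (M : ℕ) {ρ : ℕ} (hρ : L ≤ ρ) (k : ℕ) :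
    ∀ j, cubeFam false L a M ρ k j ⊆ cubeFam false L a M ρ k 0 := by
  intro j
  induction j with
  | zero => exact subset_rfl
  | succ j ih => exact (hΩ_cubeFam hL a M hρ k j).trans ih

/-- `□_{j₂} ⊂ □_{j₁}` for `j₁ ≤ j₂` (iterated (1.3)). [cite: Balaban1985RegularSpaces, (1.3) p.77] -/
theorem cubeFam_antitone {L : ℕ} (hL : 1 ≤ L) (a : Fin d → ℤ) (M : ℕ) {ρ : ℕ} (hρ : L ≤ ρ) (k : ℕ) {j₁ j₂ : ℕ} (h : j₁ ≤ j₂) :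
    cubeFam false L a M ρ k j₂ ⊆ cubeFam false L a M ρ k j₁ := by
  induction h with
  | refl => exact subset_rfl
  | step _ ih => exact (hΩ_cubeFam hL a M hρ k _).trans ih

/-- **`hmeet` at the cube member**: every tower over `𝔅_m` meets `□₀` — the corner `Lʲ•y` of `Bʲ(y)`, `y ∈ Λs j ⊂ □_j^{(j)}`, lies in `□_j ⊂ □₀`.
[cite: Balaban1985RegularSpaces, (1.5)–(1.6) p.77, p.98] -/
theorem tower_meets_cube {L : ℕ} (hL : 1 ≤ L) (a : Fin d → ℤ) (M : ℕ) {ρ : ℕ} (hρ : L ≤ ρ) {k m : ℕ} (hm : m ≤ k) :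
    ∀ j, j ≤ m → ∀ y ∈ cubeLamS L a M ρ k m j, ∃ z ∈ cubeFam false L a M ρ k 0, blockMap (L ^ j) z = y := by
  intro j hj y hy
  refine ⟨((L : ℤ) ^ j) • y, ?_, (under_iff_blockMap_eq hL j y _).mp (under_smul_self hL j y)⟩
  have h1 : ((L : ℤ) ^ j) • y ∈ cube L a M ρ k j := (smul_mem_cube_iff hL a M ρ k j y).mpr (inBox_sq_of_mem_cubeLamS hy)
  rw [← cubeFam_false_of_le L a M ρ (hj.trans hm)] at h1
  exact cubeFam_subset_zero hL a M hρ k j h1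

/-- **The core of `hdisj`**: no fine site lies under `y ∈ Λ_j = □_j^{(j)} ∖ □_{j+1}^{(j)}` AND under `y′ ∈ Λs j′` with `j < j′ ≤ m ≤ k` — it would lie
in `□_{j′} ⊂ □_{j+1}`, a union of `L^{j+1}`- hence of `Lʲ`-blocks, forcing `Lʲ•y ∈ □_{j+1}`. [cite: Balaban1985RegularSpaces, (1.5)–(1.6) p.77, (1.131) p.99, p.98] -/
theorem towers_lt_disjoint {L : ℕ} (hL : 1 ≤ L) (a : Fin d → ℤ) (M : ℕ) {ρ : ℕ} (hρ : L ≤ ρ) {k m : ℕ} (hm : m ≤ k) {j j' : ℕ}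
    (hjj : j < j') (hj' : j' ≤ m) {y y' z : Fin d → ℤ} (hy : y ∈ cubeLamS L a M ρ k m j) (hy' : y' ∈ cubeLamS L a M ρ k m j')
    (hz : Under L j y z) (hz' : Under L j' y' z) : False := by
  have hjm : j < m := lt_of_lt_of_le hjj hj'
  have hjk : j < k := lt_of_lt_of_le hjm hm
  rw [cubeLamS_of_lt L a M ρ k hjm] at hy
  -- `z ∈ □_{j'} ⊂ □_{j+1}`
  have hz1 : z ∈ cube L a M ρ k j' := (mem_cube_iff hL).mpr ⟨y', inBox_sq_of_mem_cubeLamS hy', hz'⟩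
  have hz2 : z ∈ cube L a M ρ k (j + 1) := by
    have h := cubeFam_antitone hL a M hρ k (Nat.succ_le_of_lt hjj)
    rw [cubeFam_false_of_le L a M ρ (hj'.trans hm), cubeFam_false_of_le L a M ρ (Nat.succ_le_of_lt hjk)] at h
    exact h hz1
  -- the `L^{j+1}`-block of `z` contains the whole `Lʲ`-block of `y`, in particular its corner
  obtain ⟨w, hw, hwz⟩ := (mem_cube_iff hL).mp hz2
  have hyz : flm L j z = y := by
    rw [← blockMap_pow_eq_flm]; exact (under_iff_blockMap_eq hL j y z).mp hz
  have hwz' : flm L (j + 1) z = w := by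
    rw [← blockMap_pow_eq_flm]; exact (under_iff_blockMap_eq hL (j + 1) w z).mp hwz
  have hwy : Under L 1 w y := by
    have h := under_flm hL 1 y
    rwa [← hyz, flm_one_flm, hwz', hyz] at h
  have hcorner : Under L (j + 1) w (((L : ℤ) ^ j) • y) := by
    have h := under_add_of_under hwy (under_smul_self hL j y)
    rwa [Nat.add_comm] at h
  have hin : ((L : ℤ) ^ j) • y ∈ cube L a M ρ k (j + 1) := (mem_cube_iff hL).mpr ⟨w, hw, hcorner⟩
  exact hy.2 hjk ((smul_mem_cube_succ_iff hL a M ρ hjk y).mp hin)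

/-- **`hdisj` at the cube member**: the tower blocks over `𝔅_m = {(j, y) ∣ j ≤ m, y ∈ Λs j}` are pairwise disjoint (on `□₀`, indeed on `ℤᵈ`).
[cite: Balaban1985RegularSpaces, (1.5)–(1.6) p.77 («𝔅_k = ⋃_j Λ_j», the towers partition), (1.131) p.99] -/
theorem towers_disjoint_cube {L : ℕ} (hL : 1 ≤ L) (a : Fin d → ℤ) (M : ℕ) {ρ : ℕ} (hρ : L ≤ ρ) {k m : ℕ} (hm : m ≤ k) :
    ∀ j, j ≤ m → ∀ j', j' ≤ m → ∀ y ∈ cubeLamS L a M ρ k m j, ∀ y' ∈ cubeLamS L a M ρ k m j', ∀ z ∈ cubeFam false L a M ρ k 0,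
      blockMap (L ^ j) z = y → blockMap (L ^ j') z = y' → j = j' ∧ y = y' := by
  intro j hj j' hj' y hy y' hy' z _ h1 h2
  rcases lt_trichotomy j j' with hlt | heq | hgt
  · exact absurd (towers_lt_disjoint hL a M hρ hm hlt hj' hy hy' ((under_iff_blockMap_eq hL j y z).mpr h1)
      ((under_iff_blockMap_eq hL j' y' z).mpr h2)) id
  · subst heq
    exact ⟨rfl, h1.symm.trans h2⟩
  · exact absurd (towers_lt_disjoint hL a M hρ hm hgt hj hy' hy ((under_iff_blockMap_eq hL j' y' z).mpr h2)
      ((under_iff_blockMap_eq hL j y z).mpr h1)) id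

/-! ## §2 The flat letters at the cube member -/

section Letters

variable {𝔸 : Type*} [CStarAlgebra 𝔸]

/-- **THE SEVEN FLAT [4]-LETTERS AT THE CUBE MEMBER `{□_j}` OF (1.131)** (Proposition 6's datum `(1, U₀″)`, p. 99): for `0 < d`, `η ≠ 0`,
`1 ≤ L ≤ ρ`, `m ≤ k`, weights `w_j ≥ 0`, the letters `g Δ q qs Aw c H′` of `B8Eq191FlatLettersDirichlet.exists_flatLetters_dirichlet` exist for
`Ω₀ := □₀ = cubeFam false L a M ρ k 0` and the truncated structure `Λs := cubeLamS L a M ρ k m`, with the twelve algebraic laws of the per-datum JOIN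
`B8SockHFPRD.sockHFP_body_of_join_RD` at `U₀ := 1` — NO geometric hypothesis displayed (finiteness, `hmeet`, `hdisj` are §1).
[cite: Balaban1985RegularSpaces, Prop. 6 p.99, (1.131) p.99, (1.91) p.91, (1.95) p.92; Balaban1985BackgroundPropagators, Thm 3.1 p.397, (3.25) p.394; Balaban1984PropagatorsII, p.235] -/
theorem exists_flatLetters_cubeMember (hd : 0 < d) {η : ℝ} (hη : η ≠ 0) {L : ℕ} (hL : 1 ≤ L) (a : Fin d → ℤ) (M : ℕ) {ρ : ℕ} (hρ : L ≤ ρ)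
    {k m : ℕ} (hm : m ≤ k) (w : ℕ → ℝ) (hw : ∀ j, 0 ≤ w j) :
    ∃ (g Δ : ((Fin d → ℤ) → 𝔸) →ₗ[ℂ] ((Fin d → ℤ) → 𝔸)) (q : ((Fin d → ℤ) → 𝔸) →ₗ[ℂ] (ℕ → (Fin d → ℤ) → 𝔸))
      (qs : (ℕ → (Fin d → ℤ) → 𝔸) →ₗ[ℂ] ((Fin d → ℤ) → 𝔸)) (Aw c : (ℕ → (Fin d → ℤ) → 𝔸) →ₗ[ℂ] (ℕ → (Fin d → ℤ) → 𝔸))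
      (H' : XSpace d m 𝔸 →ₗ[ℂ] ((Fin d → ℤ) → 𝔸)),
      (∀ x, ∀ y ∈ cubeFam false L a M ρ k 0, (Δ (g x) + qs (Aw (q (g x)))) y = x y) ∧
      (∀ f, q (g (g (qs (c (q f))))) = q f) ∧
      (∀ f, ∀ x ∈ cubeFam false L a M ρ k 0, Δ f x = covLap η (1 : (Fin d → ℤ) → Fin d → 𝔸ˣ) ((cubeFam false L a M ρ k 0).indicator f) x) ∧
      (∀ μ, ∀ x ∈ cubeFam false L a M ρ k 0, qs μ x = QT L m (cubeLamS L a M ρ k m) (1 : (Fin d → ℤ) → Fin d → 𝔸ˣ) μ x) ∧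
      (∀ f j, j ≤ m → ∀ y ∈ cubeLamS L a M ρ k m j,
        q f j y = QprimeIter (zdBlocking d L) (bgT L (1 : (Fin d → ℤ) → Fin d → 𝔸ˣ)) j f y) ∧
      (∀ μ j y, Aw μ j y = w j • μ j y) ∧
      (∀ (X : XSpace d m 𝔸) (x : Fin d → ℤ), x ∉ cubeFam false L a M ρ k 0 → H' X x = 0) ∧
      (∀ X Y : XSpace d m 𝔸, (∀ p, Y p = -star (X p)) → ∀ x, H' Y x = -star (H' X x)) ∧
      (∀ (Y : XSpace d m 𝔸) (j : ℕ) (hj : j ≤ m) (y : Fin d → ℤ), y ∈ cubeLamS L a M ρ k m j →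
        QprimeIter (zdBlocking d L) (bgT L (1 : (Fin d → ℤ) → Fin d → 𝔸ˣ)) j (H' Y) y = Y (⟨j, Nat.lt_succ_of_le hj⟩, y)) ∧
      (∀ f x, x ∉ cubeFam false L a M ρ k 0 → g f x = 0) ∧
      (∀ f, (∀ x ∈ cubeFam false L a M ρ k 0, IsSelfAdjoint (f x)) → ∀ x, IsSelfAdjoint (g f x)) ∧
      (∀ f, (∀ x ∈ cubeFam false L a M ρ k 0, IsSelfAdjoint (f x)) → ∀ x, IsSelfAdjoint (g (qs (c (q (g f)))) x)) :=
  exists_flatLetters_dirichlet hd hη hL m (cubeLamS L a M ρ k m) (fun j _ => cubeLamS_finite L a M ρ k m j) w hw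
    (cubeFam false L a M ρ k 0) (cubeFam_zero_finite L a M ρ k) (tower_meets_cube hL a M hρ hm) (towers_disjoint_cube hL a M hρ hm)

end Letters

end Literature.MathematicalPhysics.QuantumFieldTheory.Balaban1983to89.B8Eq191FlatLettersCubeMember

end
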